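import Literature.Geometry.Lorentzian.AchronalBoundaryProofs
import HarnessLib

/-!
# Crux `HawkingExtensionIsKerr` (stmt-FinalStateConjecture-17840), line `SketchIdeator2` —
# programme HR (horizon regularity), step D: the height of an achronal boundary is differentiable
# wherever the boundary is squeezed into a thin double cone

Helper file of the line lead (c4).  In the box of Hawking–Ellis' Prop. 6.3.1 about `q`
(`Literature.Geometry.Lorentzian.AchronalBoundaryProofs`: the boundary `∂S` of a future set is the
graph `t = u(y)` of the continuous height `u` over the transverse chart coordinate, along the
straight chart lines `t ↦ φ_q⁻¹(φ_q q + y + t v)`), suppose that at the graph point `x₁` over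
`y₁` the boundary is squeezed, for every `μ > 0`, into the double cone
`|Λ(z − φ_q x₁)| ≤ μ ‖z − φ_q x₁‖` about the hyperplane `ker Λ`, with `Λ v ≠ 0` (the hyperplane is
transverse to the lines).  Then `u` (precomposed with any continuous linear parametrisation `Bm`
of the transverse directions) is Fréchet differentiable at `y₁` with derivative
`−(Λ v)⁻¹ Λ ∘ Bm` (`hasFDerivAt_lineHeight_of_sandwich`).  With the null sandwich of step S
(`Λ = g(e⁻¹ ·, K)`, `K` the null generator) this is the differentiability of a horizon at interior
points of its generators (Beem–Królak 1998), in the form needed by the lead's assembly.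
-/

noncomputable section

set_option linter.dupNamespace false

namespace Summit.FinalStateConjecture.FinalStateConjecture.Theorems.HawkingExtensionIsKerr.SketchIdeator2

open Set Filter Metric Bundle Function Literature.Geometry.Lorentzian LorentzianMetric
open scoped Manifold ContDiff Topology

/-- **The algebra of step D.**  If `|a| X ≤ μ (n_B h + n_v (X + n_ℓ h))` with
`μ ≤ |a| / (2 (n_v + 1))` and `μ ≤ c |a| / (2 (n_B + n_v n_ℓ + 1))`, then `X ≤ c h`
(all quantities non-negative, `a > 0`). [folklore] -/
theorem hrHeight_algebra {a μ c nB nv nℓ X h : ℝ} (ha : 0 < a) (hc : 0 < c) (hnB : 0 ≤ nB)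
    (hnv : 0 ≤ nv) (hnℓ : 0 ≤ nℓ) (hX : 0 ≤ X) (hh : 0 ≤ h)
    (hμ1 : μ ≤ a / (2 * (nv + 1))) (hμ2 : μ ≤ c * a / (2 * (nB + nv * nℓ + 1)))
    (hineq : a * X ≤ μ * (nB * h + nv * (X + nℓ * h))) : X ≤ c * h := by
  -- `(a - μ nv) X ≤ μ (nB + nv nℓ) h` and `a - μ nv ≥ a / 2`
  have h1 : a / 2 ≤ a - μ * nv := by
    have : μ * nv ≤ a / (2 * (nv + 1)) * nv := mul_le_mul_of_nonneg_right hμ1 hnv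
    have h2 : a / (2 * (nv + 1)) * nv ≤ a / 2 := by
      rw [div_mul_eq_mul_div, div_le_div_iff₀ (by positivity) (by positivity)]
      nlinarith
    linarith
  have h3 : (a - μ * nv) * X ≤ μ * (nB + nv * nℓ) * h := by nlinarith
  have h4 : a / 2 * X ≤ μ * (nB + nv * nℓ) * h := (mul_le_mul_of_nonneg_right h1 hX).trans h3
  have h5 : μ * (nB + nv * nℓ) ≤ c * a / 2 := by
    have : μ * (nB + nv * nℓ) ≤ c * a / (2 * (nB + nv * nℓ + 1)) * (nB + nv * nℓ) :=
      mul_le_mul_of_nonneg_right hμ2 (by positivity)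
    have h6 : c * a / (2 * (nB + nv * nℓ + 1)) * (nB + nv * nℓ) ≤ c * a / 2 := by
      rw [div_mul_eq_mul_div, div_le_div_iff₀ (by positivity) (by positivity)]
      have : 0 ≤ c * a := by positivity
      nlinarith
    linarith
  have h7 : a / 2 * X ≤ c * a / 2 * h := h4.trans (mul_le_mul_of_nonneg_right h5 hh)
  nlinarith

variable {E : Type*} [NormedAddCommGroup E] [NormedSpace ℝ E] {H : Type*} [TopologicalSpace H]
  {I : ModelWithCorners ℝ E H} {n : ℕ∞ω} {M : Type*} [TopologicalSpace M] [ChartedSpace H M]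
  [IsManifold I ∞ M] {g : LorentzianMetric I n M} {τ : TimeOrientation g}
  {E' : Type*} [NormedAddCommGroup E'] [NormedSpace ℝ E']

/-- **Step D: the height of an achronal boundary is differentiable at a point where the boundary
is squeezed into arbitrarily thin double cones about a hyperplane transverse to the lines.**  In
the box of Hawking–Ellis' Prop. 6.3.1 about `q` (line-point map `P y t = φ_q⁻¹(φ_q q + y + t v)`,
cone radius `ρ`, half-height `δ`, future set `S` with top points in `int S` and bottom points in
`int Sᶜ` over the transverse ball `‖y‖ < ε`), let `Bm : E' → E` parametrise transverse directions,
`y₁` a parameter with `‖Bm y₁‖ < ε`, `h₁` the height over `Bm y₁` and `z₁ = φ_q q + Bm y₁ + h₁ v`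
the chart image of the boundary point over it.  If `Λ : E → ℝ` is a continuous linear functional
with `Λ v ≠ 0` such that for every `μ > 0` the boundary points `φ_q⁻¹ z`, `z` near `z₁`, satisfy
`|Λ (z − z₁)| ≤ μ ‖z − z₁‖`, then `y ↦ height (Bm y)` has Fréchet derivative `−(Λ v)⁻¹ • Λ ∘ Bm` at
`y₁`.  (Beem–Królak, J. Math. Phys. 39 (1998) 6001, Thm 3.5, in graph form; Hawking–Ellis 1973,
Prop. 6.3.1 for the box.) -/
theorem hasFDerivAt_lineHeight_of_sandwich [BoundarylessManifold I M]
    {q : M} {v : E} {ρ δ : ℝ} {P : E → ℝ → M}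
    (hP : ∀ y t, P y t = (extChartAt I q).symm (extChartAt I q q + y + t • v))
    (hρ : ∀ z u : E, ‖z - extChartAt I q q‖ < ρ → ‖u - v‖ < ρ → (z, u) ∈ chartCone g τ q)
    (hδv : δ * ‖v‖ ≤ ρ / 2) {S : Set M} (hS : g.IsFutureSet τ S) {ε : ℝ} (hε : ε ≤ ρ / 2)
    (hδ : 0 < δ) (htop : ∀ y : E, ‖y‖ < ε → P y δ ∈ interior S)
    (hbot : ∀ y : E, ‖y‖ < ε → P y (-δ) ∈ interior Sᶜ)
    (Bm : E' →L[ℝ] E) {y₁ : E'} (hy₁ : ‖Bm y₁‖ < ε) (Λ : E →L[ℝ] ℝ) (hΛv : Λ v ≠ 0)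
    (hsand : ∀ μ : ℝ, 0 < μ →
      ∀ᶠ z in 𝓝 (extChartAt I q q + Bm y₁ +
        (sInf {t : ℝ | t ∈ Icc (-δ) δ ∧ P (Bm y₁) t ∈ S}) • v),
        (extChartAt I q).symm z ∈ frontier S →
          |Λ (z - (extChartAt I q q + Bm y₁ +
            (sInf {t : ℝ | t ∈ Icc (-δ) δ ∧ P (Bm y₁) t ∈ S}) • v))| ≤
            μ * ‖z - (extChartAt I q q + Bm y₁ +
              (sInf {t : ℝ | t ∈ Icc (-δ) δ ∧ P (Bm y₁) t ∈ S}) • v)‖) :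
    HasFDerivAt (fun y : E' ↦ sInf {t : ℝ | t ∈ Icc (-δ) δ ∧ P (Bm y) t ∈ S})
      (-(Λ v)⁻¹ • (Λ.comp Bm)) y₁ := by
  -- notation
  set hgt : E → ℝ := fun y ↦ sInf {t : ℝ | t ∈ Icc (-δ) δ ∧ P y t ∈ S} with hhgt
  set z₀ : E := extChartAt I q q with hz₀
  set Z : E' → E := fun y ↦ z₀ + Bm y + hgt (Bm y) • v with hZ
  set ℓ₁ : E' →L[ℝ] ℝ := -(Λ v)⁻¹ • (Λ.comp Bm) with hℓ₁
  change HasFDerivAt (fun y : E' ↦ hgt (Bm y)) ℓ₁ y₁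
  -- continuity of the height and of `Z` at `y₁`
  have hcont : ContinuousAt (fun y : E' ↦ hgt (Bm y)) y₁ :=
    (continuousAt_lineHeight hP hρ hδv hS hε hδ htop hbot hy₁).comp Bm.continuous.continuousAt
  have hZcont : ContinuousAt Z y₁ :=
    (continuousAt_const.add Bm.continuous.continuousAt).add (hcont.smul continuousAt_const)
  -- graph points are boundary points
  have hfront : ∀ y : E', ‖Bm y‖ < ε → (extChartAt I q).symm (Z y) ∈ frontier S := by
    intro y hy
    have h := linePoint_lineHeight_mem_frontier hP hρ hδv hS (hy.trans_le hε) hδ (htop _ hy)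
      (hbot _ hy)
    rwa [hP] at h
  -- the little-o estimate
  rw [hasFDerivAt_iff_isLittleO, Asymptotics.isLittleO_iff]
  intro c hc
  -- constants
  set a : ℝ := |Λ v| with ha
  have ha0 : 0 < a := abs_pos.mpr hΛv
  set nB : ℝ := ‖Bm‖
  set nv : ℝ := ‖v‖
  set nℓ : ℝ := ‖ℓ₁‖
  set μ : ℝ := min (a / (2 * (nv + 1))) (c * a / (2 * (nB + nv * nℓ + 1))) with hμ
  have hμ0 : 0 < μ := lt_min (by positivity) (by positivity)
  have hμ1 : μ ≤ a / (2 * (nv + 1)) := min_le_left _ _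
  have hμ2 : μ ≤ c * a / (2 * (nB + nv * nℓ + 1)) := min_le_right _ _
  -- pull the sandwich back along `Z`
  have hev₁ : ∀ᶠ y in 𝓝 y₁, (extChartAt I q).symm (Z y) ∈ frontier S →
      |Λ (Z y - Z y₁)| ≤ μ * ‖Z y - Z y₁‖ := hZcont.eventually (hsand μ hμ0)
  have hev₂ : ∀ᶠ y in 𝓝 y₁, ‖Bm y‖ < ε :=
    (Bm.continuous.norm.continuousAt (x := y₁)).eventually (gt_mem_nhds hy₁)
  filter_upwards [hev₁, hev₂] with y hy hyε
  have hineq := hy (hfront y hyε)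
  -- the algebra: `Z y - Z y₁ = Bm (y - y₁) + d • v`, `Λ (Bm h) = -(Λ v) ℓ₁ h`
  set d : ℝ := hgt (Bm y) - hgt (Bm y₁) with hd
  have hZdiff : Z y - Z y₁ = Bm (y - y₁) + d • v := by
    simp only [hZ, hd, map_sub, sub_smul]; abel
  have hΛBm : Λ (Bm (y - y₁)) = -(Λ v) * ℓ₁ (y - y₁) := by
    simp only [hℓ₁, FunLike.coe_smul, Pi.smul_apply, ContinuousLinearMap.comp_apply, smul_eq_mul]
    field_simp
  have hΛZ : Λ (Z y - Z y₁) = (Λ v) * (d - ℓ₁ (y - y₁)) := by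
    rw [hZdiff, map_add, map_smul, hΛBm, smul_eq_mul]; ring
  rw [hΛZ, abs_mul] at hineq
  -- norms
  have hnorm : ‖Z y - Z y₁‖ ≤ nB * ‖y - y₁‖ + nv * |d| := by
    rw [hZdiff]
    calc ‖Bm (y - y₁) + d • v‖ ≤ ‖Bm (y - y₁)‖ + ‖d • v‖ := norm_add_le _ _
      _ ≤ nB * ‖y - y₁‖ + nv * |d| := by
        rw [norm_smul, Real.norm_eq_abs, mul_comm |d|]
        exact add_le_add (Bm.le_opNorm _) le_rfl
  have hdle : |d| ≤ |d - ℓ₁ (y - y₁)| + nℓ * ‖y - y₁‖ := by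
    calc |d| = |(d - ℓ₁ (y - y₁)) + ℓ₁ (y - y₁)| := by ring_nf
      _ ≤ |d - ℓ₁ (y - y₁)| + |ℓ₁ (y - y₁)| := abs_add_le _ _
      _ ≤ |d - ℓ₁ (y - y₁)| + nℓ * ‖y - y₁‖ := by
        refine add_le_add le_rfl ?_
        rw [← Real.norm_eq_abs]; exact ℓ₁.le_opNorm _
  have hmain : a * |d - ℓ₁ (y - y₁)| ≤
      μ * (nB * ‖y - y₁‖ + nv * (|d - ℓ₁ (y - y₁)| + nℓ * ‖y - y₁‖)) := by
    calc a * |d - ℓ₁ (y - y₁)| ≤ μ * ‖Z y - Z y₁‖ := hineq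
      _ ≤ μ * (nB * ‖y - y₁‖ + nv * |d|) := mul_le_mul_of_nonneg_left hnorm hμ0.le
      _ ≤ μ * (nB * ‖y - y₁‖ + nv * (|d - ℓ₁ (y - y₁)| + nℓ * ‖y - y₁‖)) := by
        gcongr
  have hres := hrHeight_algebra ha0 hc (norm_nonneg _) (norm_nonneg _) (norm_nonneg _)
    (abs_nonneg _) (norm_nonneg _) hμ1 hμ2 hmain
  simpa [Real.norm_eq_abs, hd] using hres

/-- **Registered sub-goal form of step D** (closed statement, crux stmt-FinalStateConjecture-17840):
the height of the box of Hawking–Ellis' Prop. 6.3.1 in the space-time of a stationary black hole,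
over transverse coordinates `B : ℝ³ → ℝ⁴`, is differentiable at a point where the boundary is
squeezed into thin double cones about a hyperplane `ker Λ` transverse to the lines. -/
theorem stub_hr_heightDeriv : ∀ (𝓑 : StationaryAFBlackHole.{0}) (q : 𝓑.carrier) (v : E4) (ρ δ ε : ℝ) (P : E4 → ℝ → 𝓑.carrier) (S : Set 𝓑.carrier) (Bm : E3 →L[ℝ] E4) (y₁ : E3) (Λ : E4 →L[ℝ] ℝ), (∀ y t, P y t = (extChartAt (𝓡 4) q).symm (extChartAt (𝓡 4) q q + y + t • v)) → (∀ z u : E4, ‖z - extChartAt (𝓡 4) q q‖ < ρ → ‖u - v‖ < ρ → (z, u) ∈ LorentzianMetric.chartCone 𝓑.metric 𝓑.timeOrientation q) → δ * ‖v‖ ≤ ρ / 2 → 𝓑.metric.IsFutureSet 𝓑.timeOrientation S → ε ≤ ρ / 2 → 0 < δ → (∀ y : E4, ‖y‖ < ε → P y δ ∈ interior S) → (∀ y : E4, ‖y‖ < ε → P y (-δ) ∈ interior Sᶜ) → ‖Bm y₁‖ < ε → Λ v ≠ 0 → (∀ μ : ℝ, 0 < μ → ∀ᶠ z in 𝓝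 (extChartAt (𝓡 4) q q + Bm y₁ + (sInf {t : ℝ | t ∈ Set.Icc (-δ) δ ∧ P (Bm y₁) t ∈ S}) • v), (extChartAt (𝓡 4) q).symm z ∈ frontier S → |Λ (z - (extChartAt (𝓡 4) q q + Bm y₁ + (sInf {t : ℝ | t ∈ Set.Icc (-δ) δ ∧ P (Bm y₁) t ∈ S}) • v))| ≤ μ * ‖z - (extChartAt (𝓡 4) q q + Bm y₁ + (sInf {t : ℝ | t ∈ Set.Icc (-δ) δ ∧ P (Bm y₁) t ∈ S}) • v)‖) → HasFDerivAt (fun y : E3 ↦ sInf {t : ℝ | t ∈ Set.Icc (-δ) δ ∧ P (Bm y) t ∈ S}) (-(Λ v)⁻¹ • (Λ.comp Bm)) y₁ :=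
  fun _ _ _ _ _ _ _ _ Bm _ Λ hP hρ hδv hS hε hδ htop hbot hy₁ hΛv hsand ↦
    hasFDerivAt_lineHeight_of_sandwich hP hρ hδv hS hε hδ htop hbot Bm hy₁ Λ hΛv hsand

end Summit.FinalStateConjecture.FinalStateConjecture.Theorems.HawkingExtensionIsKerr.SketchIdeator2

end
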